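import Literature.NumberTheory.Transcendental.GammaGeometricStep
import Literature.NumberTheory.Transcendental.GammaFieldRegularity
import Literature.NumberTheory.Transcendental.GammaIsoLogStep
import Literature.NumberTheory.Transcendental.GammaStrongDescent
import Literature.FieldTheory.Regular.FiniteAlgebraicClosureIF
import HarnessLib

/-!
# Absorbing the relative algebraic closure (Bays–Kirby 2018, Prop. 11.2: "we may assume `A^full ∧ B = A`")

M. Bays, J. Kirby, *Pseudo-exponential maps, variants, and quasiminimality*, Algebra & Number
Theory 12 (2018), proof of Lemma 8.3 / Prop. 11.2. Given a Γ-isomorphism `c ↦ c'` over `K`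
between strong bases and a basis `u` of a Γ-algebraic extension `B = K + ℚc + ℚu` of
`A = K + ℚc` such that no element of `B ∖ A` is algebraic over `Γ(A)`, we enlarge `c` by finitely
many elements `x̄` algebraic over `Γ(A)` (generators of the relative algebraic closure of the
Γ-field `⟨K c⟩` in `⟨K c⟩(u, exp u)`, `Literature.FieldTheory.Regular.exists_finset_isAlgClosedIn_of_fg`),
extending the Γ-isomorphism along them one algebraic step at a time
(`GammaField.IsGammaIso.exists_append_of_forall_mem_acl`, from
`GammaField.IsGammaIso.exists_append_single_of_mem_acl`), so that afterwards the Γ-field of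
the base is relatively algebraically closed in the field generated by `(u, exp u)` over it
(`GammaField.isAlgClosedIn_adjoinField_allGens_append`) while all the dimension data are
unchanged (`GammaField.exists_absorb`).

## References

* M. Bays, J. Kirby, *Pseudo-exponential maps, variants, and quasiminimality*, Algebra & Number
  Theory 12 (2018) 493–549: Lemma 3.26, Lemma 4.8, Cor. 7.4, Lemma 8.3 (proof), Prop. 11.2.
-/

noncomputable section

open Set

universe u

namespace Literature.NumberTheory.Transcendental

namespace GammaField

open Literature.ModelTheory.ExponentialFields.ExponentialRing ZilberSaturationMain
  Literature.FieldTheory.Regular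

variable {F : Type u} [Field F] [CharZero F] [Literature.ModelTheory.ExponentialFields.ExponentialRing F]
variable {K : Submodule ℚ F} {N n : ℕ}

/-! ### Tuples: splitting off the last element -/

/-- `(c, x) = ((c, x_{<s}), x_s)`. [folklore] -/
theorem append_eq_append_append_single {α : Type*} {s : ℕ} (c : Fin N → α) (x : Fin (s + 1) → α) :
    Fin.append c x = Fin.append (Fin.append c (x ∘ Fin.castSucc)) ![x (Fin.last s)] := by
  rw [Fin.append_right_eq_snoc, Matrix.cons_val_zero, ← Fin.append_snoc]
  congr 1
  exact (Fin.snoc_init_self x).symm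

omit [Literature.ModelTheory.ExponentialFields.ExponentialRing F] in
/-- The last element of a tuple linearly independent over `Λ` is not in `Λ + ℚ(the others)`.
[folklore] -/
theorem LinIndepOver.last_notMem {Λ : Submodule ℚ F} {s : ℕ} {x : Fin (s + 1) → F}
    (hx : LinIndepOver Λ x) : x (Fin.last s) ∉ Λ ⊔ Submodule.span ℚ (range (x ∘ Fin.castSucc)) := by
  intro hmem
  obtain ⟨κ, hκ, w, hw, hsum⟩ := Submodule.mem_sup.1 hmem
  obtain ⟨q, rfl⟩ := (Submodule.mem_span_range_iff_exists_fun ℚ).1 hw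
  have hrel : ∑ i, (Fin.snoc (fun i => -q i) (1 : ℚ) : Fin (s + 1) → ℚ) i • x i ∈ Λ := by
    rw [Fin.sum_univ_castSucc]
    simp only [Fin.snoc_castSucc, Fin.snoc_last, one_smul, neg_smul, Finset.sum_neg_distrib]
    have : -∑ i, q i • (x ∘ Fin.castSucc) i + x (Fin.last s) = κ := by rw [← hsum]; abel
    simp only [Function.comp_apply] at this
    rw [this]
    exact hκ
  have h0 := hx _ hrel
  have := congrFun h0 (Fin.last s)
  simp at this

omit [Literature.ModelTheory.ExponentialFields.ExponentialRing F] in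
/-- Linear independence over a smaller subspace. [folklore] -/
theorem LinIndepOver.of_le {Λ Λ' : Submodule ℚ F} (hle : Λ ≤ Λ') {s : ℕ} {x : Fin s → F}
    (hx : LinIndepOver Λ' x) : LinIndepOver Λ x :=
  fun q hq => hx q (hle hq)

/-! ### Iterated algebraic steps -/

/-- **Extending a Γ-isomorphism along a tuple of algebraic elements** (Lemma 3.26 iterated): if
`c ↦ c'` is a Γ-isomorphism over `K` between strong bases and `x̄` is linearly independent over
`K + ℚc` with every `x̄ⱼ` algebraic over `Γ(K + ℚc)`, there is `x̄'` with `(c, x̄) ↦ (c', x̄')` a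
Γ-isomorphism over `K` and `K + ℚc' + ℚx̄' ◁ F`.
[cite: BaysKirby2018ANT, Lemma 3.26, Lemma 4.8] -/
theorem IsGammaIso.exists_append_of_forall_mem_acl [IsAlgClosed F] :
    ∀ {s N : ℕ} {c c' : Fin N → F} (_h : IsGammaIso K c c')
      (_hs : IsStrong (K ⊔ Submodule.span ℚ (range c)))
      (_hs' : IsStrong (K ⊔ Submodule.span ℚ (range c'))) (x : Fin s → F),
      (∀ j, x j ∈ acl (gens (K ⊔ Submodule.span ℚ (range c)))) →
      LinIndepOver (K ⊔ Submodule.span ℚ (range c)) x →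
      ∃ x' : Fin s → F, IsGammaIso K (Fin.append c x) (Fin.append c' x') ∧
        IsStrong (K ⊔ Submodule.span ℚ (range (Fin.append c' x')))
  | 0, N, c, c', h, hs, hs', x, _, _ => by
    refine ⟨Fin.elim0, ?_, ?_⟩
    · have hx : x = Fin.elim0 := funext fun i => i.elim0
      rw [hx, Fin.append_elim0, Fin.append_elim0]
      have ht := h.transfer (y := c ∘ Fin.cast (Nat.add_zero N)) fun j =>
        Submodule.mem_sup_right (Submodule.subset_span ⟨_, rfl⟩)
      have heq : (fun j => h.transport ((c ∘ Fin.cast (Nat.add_zero N)) j)) = c' ∘ Fin.cast (Nat.add_zero N) := by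
        funext j
        exact h.transport_apply _
      rw [heq] at ht
      exact ht
    · rw [Fin.append_elim0]
      have : range (c' ∘ Fin.cast (Nat.add_zero N)) = range c' := by
        ext z
        constructor
        · rintro ⟨j, rfl⟩; exact ⟨_, rfl⟩
        · rintro ⟨j, rfl⟩; exact ⟨Fin.cast (Nat.add_zero N).symm j, by simp⟩
      rw [this]
      exact hs'
  | s + 1, N, c, c', h, hs, hs', x, hacl, hind => by
    -- first the initial segment
    obtain ⟨x₀', h₀, hs₀'⟩ := IsGammaIso.exists_append_of_forall_mem_acl h hs hs' (x ∘ Fin.castSucc)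
      (fun j => hacl _) (fun q hq => by
        have := hind (Fin.snoc q 0) (by
          rw [Fin.sum_univ_castSucc]
          simpa only [Fin.snoc_castSucc, Fin.snoc_last, zero_smul, add_zero, Function.comp_apply] using hq)
        funext j
        have hj := congrFun this j.castSucc
        simpa only [Fin.snoc_castSucc, Pi.zero_apply] using hj)
    have hs₀ : IsStrong (K ⊔ Submodule.span ℚ (range (Fin.append c (x ∘ Fin.castSucc)))) := by
      rw [ZilberHomogeneity.range_append, Submodule.span_union, ← sup_assoc]
      exact hs.sup_span_of_forall_mem_acl _ fun j => hacl _
    -- then the last element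
    have hxl : x (Fin.last s) ∈ acl (gens (K ⊔ Submodule.span ℚ (range (Fin.append c (x ∘ Fin.castSucc))))) :=
      acl_mono (gens_mono (by
        rw [ZilberHomogeneity.range_append, Submodule.span_union, ← sup_assoc]; exact le_sup_left)) (hacl _)
    have hxlX : x (Fin.last s) ∉ K ⊔ Submodule.span ℚ (range (Fin.append c (x ∘ Fin.castSucc))) := by
      rw [ZilberHomogeneity.range_append, Submodule.span_union, ← sup_assoc]
      exact hind.last_notMem
    obtain ⟨xl', hacl', hnot', hγ⟩ := h₀.exists_append_single_of_mem_acl hs₀ hs₀' hxl hxlX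
    refine ⟨Fin.snoc x₀' xl', ?_, ?_⟩
    · rw [append_eq_append_append_single c x, append_eq_append_append_single c']
      simpa only [Fin.snoc_last, Fin.init_snoc, show (Fin.snoc x₀' xl' ∘ Fin.castSucc) = x₀' from
        funext fun i => Fin.snoc_castSucc (α := fun _ => F) _ _ i] using hγ
    · rw [append_eq_append_append_single c', sup_span_range_append_single]
      simp only [Fin.snoc_last, show (Fin.snoc x₀' xl' ∘ Fin.castSucc) = x₀' from
        funext fun i => Fin.snoc_castSucc (α := fun _ => F) _ _ i]
      exact isStrong_sup_span_singleton_of_mem_acl hs₀' hacl' hnot'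

/-! ### The absorption -/

omit [Literature.ModelTheory.ExponentialFields.ExponentialRing F] in
/-- `u` stays linearly independent over `A + ℚx̄` when `x̄` is linearly independent over `A + ℚu`.
[folklore] -/
theorem LinIndepOver.sup_span_of_linIndepOver_sup {A : Submodule ℚ F} {s : ℕ} {u : Fin n → F}
    {x : Fin s → F} (hu : LinIndepOver A u) (hx : LinIndepOver (A ⊔ Submodule.span ℚ (range u)) x) :
    LinIndepOver (A ⊔ Submodule.span ℚ (range x)) u := by
  intro q hq
  obtain ⟨a, ha, w, hw, hsum⟩ := Submodule.mem_sup.1 hq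
  obtain ⟨r, rfl⟩ := (Submodule.mem_span_range_iff_exists_fun ℚ).1 hw
  have hr : ∑ i, r i • x i ∈ A ⊔ Submodule.span ℚ (range u) := by
    have : ∑ i, r i • x i = ∑ i, q i • u i - a := by rw [← hsum]; abel
    rw [this]
    exact sub_mem (Submodule.mem_sup_right (Submodule.sum_mem _ fun i _ =>
      Submodule.smul_mem _ _ (Submodule.subset_span ⟨i, rfl⟩))) (Submodule.mem_sup_left ha)
  have hr0 := hx r hr
  have hqa : ∑ i, q i • u i = a := by
    rw [← hsum, hr0]
    simp
  exact hu q (hqa ▸ ha)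

/-- **Absorbing the relative algebraic closure.** Let `c ↦ c'` be a Γ-isomorphism over `K` between
strong bases, `u` a basis (linearly independent over `A = K + ℚc`) of a Γ-algebraic extension
(`td(u/A) = n`) such that every element of `B = A + ℚu` algebraic over `Γ(A)` lies in `A`. Then
there are `x̄`, algebraic over `Γ(A)` and linearly independent over `B`, and `x̄'` with:
`(c, x̄) ↦ (c', x̄')` a Γ-isomorphism over `K`; `K + ℚc + ℚx̄ ◁ F` and `K + ℚc' + ℚx̄' ◁ F`; `u`
linearly independent over `K + ℚc + ℚx̄` with `td(u/K + ℚc + ℚx̄) = n`; and the Γ-field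
`⟨K c x̄⟩` relatively algebraically closed in `⟨K c x̄⟩(u, exp u)`.
[cite: BaysKirby2018ANT, Lemma 8.3 (proof: "we may assume `A^full ∧ B = A`"), Cor. 7.4, Prop. 11.2] -/
theorem exists_absorb [IsAlgClosed F] {c c' : Fin N → F} (hiso : IsGammaIso K c c')
    (hs : IsStrong (K ⊔ Submodule.span ℚ (range c)))
    (hs' : IsStrong (K ⊔ Submodule.span ℚ (range c'))) {u : Fin n → F}
    (hu : LinIndepOver (K ⊔ Submodule.span ℚ (range c)) u)
    (htd : td (K ⊔ Submodule.span ℚ (range c)) (Submodule.span ℚ (range u)) = n)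
    (hcase : ∀ z ∈ (K ⊔ Submodule.span ℚ (range c)) ⊔ Submodule.span ℚ (range u),
      z ∈ acl (gens (K ⊔ Submodule.span ℚ (range c))) → z ∈ K ⊔ Submodule.span ℚ (range c)) :
    ∃ (s : ℕ) (x x' : Fin s → F),
      IsGammaIso K (Fin.append c x) (Fin.append c' x') ∧
      (∀ j, x j ∈ acl (gens (K ⊔ Submodule.span ℚ (range c)))) ∧
      LinIndepOver ((K ⊔ Submodule.span ℚ (range c)) ⊔ Submodule.span ℚ (range u)) x ∧
      IsStrong (K ⊔ Submodule.span ℚ (range (Fin.append c x))) ∧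
      IsStrong (K ⊔ Submodule.span ℚ (range (Fin.append c' x'))) ∧
      LinIndepOver (K ⊔ Submodule.span ℚ (range (Fin.append c x))) u ∧
      td (K ⊔ Submodule.span ℚ (range (Fin.append c x))) (Submodule.span ℚ (range u)) = n ∧
      ∀ z ∈ IntermediateField.adjoin (fieldOf K) (allGens (Fin.append c x) ∪ range (gammaPt u)),
        IsAlgebraic (bfld K (Fin.append c x)) z → z ∈ bfld K (Fin.append c x) := by
  classical
  -- the relative algebraic closure of `⟨K c⟩` in `Ω₂ = ⟨K c⟩(u, exp u)` is finitely generated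
  have hfg : (IntermediateField.adjoin (bfld K c) (range (gammaPt u))).FG :=
    ⟨Finset.univ.image (gammaPt u), by rw [Finset.coe_image, Finset.coe_univ, image_univ]⟩
  obtain ⟨s₀, hs₀Ω, hs₀alg, hclos⟩ := exists_finset_isAlgClosedIn_of_fg _ hfg
  -- enumerate `s₀` and extract a maximal `B`-linearly independent sub-tuple
  set y : Fin s₀.card → F := fun i => (s₀.equivFin.symm i : F) with hy
  have hys₀ : ∀ i, y i ∈ s₀ := fun i => (s₀.equivFin.symm i).2
  obtain ⟨s, σ, hxind, hspan⟩ := exists_linIndepOver_comp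
    ((K ⊔ Submodule.span ℚ (range c)) ⊔ Submodule.span ℚ (range u)) y
  -- facts about `x = y ∘ σ`
  have hxalg : ∀ j, IsAlgebraic (bfld K c) ((y ∘ σ) j) := fun j => hs₀alg _ (hys₀ _)
  have hxacl : ∀ j, (y ∘ σ) j ∈ acl (gens (K ⊔ Submodule.span ℚ (range c))) := fun j =>
    acl_subset_acl_of_subset (coe_bfld_subset_acl K c) (mem_acl_coe_of_isAlgebraic _ (hxalg j))
  have hxA : LinIndepOver (K ⊔ Submodule.span ℚ (range c)) (y ∘ σ) := hxind.of_le le_sup_left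
  -- extend the Γ-isomorphism along `x`
  obtain ⟨x', hγ, hstrong'⟩ := hiso.exists_append_of_forall_mem_acl hs hs' (y ∘ σ) hxacl hxA
  have hrange : K ⊔ Submodule.span ℚ (range (Fin.append c (y ∘ σ))) =
      (K ⊔ Submodule.span ℚ (range c)) ⊔ Submodule.span ℚ (range (y ∘ σ)) := by
    rw [ZilberHomogeneity.range_append, Submodule.span_union, ← sup_assoc]
  have hstrong : IsStrong (K ⊔ Submodule.span ℚ (range (Fin.append c (y ∘ σ)))) := by
    rw [hrange]; exact hs.sup_span_of_forall_mem_acl _ hxacl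
  have hu₂ : LinIndepOver (K ⊔ Submodule.span ℚ (range (Fin.append c (y ∘ σ)))) u := by
    rw [hrange]; exact hu.sup_span_of_linIndepOver_sup hxind
  -- dimensions: `δ(u/A) = 0`, `δ(x/A) = δ(x/B) = 0`, hence `td(u/A + ℚx) = n`
  have hfgu : IsFG (K ⊔ Submodule.span ℚ (range c)) (Submodule.span ℚ (range u)) :=
    isFG_span_of_finite _ (finite_range u)
  have hδu : predim (K ⊔ Submodule.span ℚ (range c)) (Submodule.span ℚ (range u)) = 0 := by
    rw [predim, htd, ldim_span_eq_of_linIndepOver hu]; simp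
  have hB : IsStrong ((K ⊔ Submodule.span ℚ (range c)) ⊔ Submodule.span ℚ (range u)) :=
    hs.of_predim_eq_zero le_sup_left (isFG_sup_left.2 hfgu) (by rwa [predim_sup_left])
  have hδxA : predim (K ⊔ Submodule.span ℚ (range c)) (Submodule.span ℚ (range (y ∘ σ))) = 0 := by
    refine le_antisymm (predim_span_chain_nonpos _ _ fun j => ?_)
      (isStrong_iff.1 hs _ (isFG_span_of_finite _ (finite_range _)))
    exact td_span_singleton_le_one_of_mem_acl (acl_mono (gens_mono le_sup_left) (hxacl j))
  have hδxB : predim ((K ⊔ Submodule.span ℚ (range c)) ⊔ Submodule.span ℚ (range u))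
      (Submodule.span ℚ (range (y ∘ σ))) = 0 := by
    refine le_antisymm (predim_span_chain_nonpos _ _ fun j => ?_)
      (isStrong_iff.1 hB _ (isFG_span_of_finite _ (finite_range _)))
    exact td_span_singleton_le_one_of_mem_acl
      (acl_mono (gens_mono (le_sup_left.trans le_sup_left)) (hxacl j))
  have htd₂ : td (K ⊔ Submodule.span ℚ (range (Fin.append c (y ∘ σ)))) (Submodule.span ℚ (range u)) = n := by
    rw [hrange]
    -- `δ(u/A + ℚx) = 0` from the two ways of computing `δ(B + ℚx/A)`
    have hfg1 : IsFG (K ⊔ Submodule.span ℚ (range c))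
        ((K ⊔ Submodule.span ℚ (range c)) ⊔ Submodule.span ℚ (range (y ∘ σ)) ⊔ Submodule.span ℚ (range u)) := by
      rw [sup_assoc]
      exact isFG_sup_left.2 ((isFG_span_of_finite _ (finite_range _)).sup hfgu)
    have hswap : (K ⊔ Submodule.span ℚ (range c)) ⊔ Submodule.span ℚ (range (y ∘ σ)) ⊔ Submodule.span ℚ (range u) =
        (K ⊔ Submodule.span ℚ (range c)) ⊔ Submodule.span ℚ (range u) ⊔ Submodule.span ℚ (range (y ∘ σ)) := by
      simp only [sup_assoc]
      rw [sup_comm (Submodule.span ℚ (range (y ∘ σ)))]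
    have e1 := predim_add (le_sup_left : K ⊔ Submodule.span ℚ (range c) ≤
        (K ⊔ Submodule.span ℚ (range c)) ⊔ Submodule.span ℚ (range (y ∘ σ)))
      (le_sup_left : (K ⊔ Submodule.span ℚ (range c)) ⊔ Submodule.span ℚ (range (y ∘ σ)) ≤
        (K ⊔ Submodule.span ℚ (range c)) ⊔ Submodule.span ℚ (range (y ∘ σ)) ⊔ Submodule.span ℚ (range u)) hfg1
    have e2 := predim_add (le_sup_left : K ⊔ Submodule.span ℚ (range c) ≤
        (K ⊔ Submodule.span ℚ (range c)) ⊔ Submodule.span ℚ (range u))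
      (le_sup_left : (K ⊔ Submodule.span ℚ (range c)) ⊔ Submodule.span ℚ (range u) ≤
        (K ⊔ Submodule.span ℚ (range c)) ⊔ Submodule.span ℚ (range u) ⊔ Submodule.span ℚ (range (y ∘ σ)))
      (by rw [← hswap]; exact hfg1)
    rw [predim_sup_left, predim_sup_left, hδxA] at e1
    rw [predim_sup_left, predim_sup_left, hδu, hδxB, ← hswap] at e2
    have hδ2 : predim ((K ⊔ Submodule.span ℚ (range c)) ⊔ Submodule.span ℚ (range (y ∘ σ)))
        (Submodule.span ℚ (range u)) = 0 := by linarith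
    have hld : ldim ((K ⊔ Submodule.span ℚ (range c)) ⊔ Submodule.span ℚ (range (y ∘ σ)))
        (Submodule.span ℚ (range u)) = n := ldim_span_eq_of_linIndepOver (hrange ▸ hu₂)
    rw [predim, hld] at hδ2
    have hne : td ((K ⊔ Submodule.span ℚ (range c)) ⊔ Submodule.span ℚ (range (y ∘ σ)))
        (Submodule.span ℚ (range u)) ≠ ⊤ := td_ne_top (isFG_span_of_finite _ (finite_range u))
    rw [← ENat.coe_toNat hne]
    congr 1
    omega
  -- regularity: `E(x) = E(s₀)` is relatively algebraically closed in `Ω₂`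
  have hmemΩ₂ : ∀ z : F, z ∈ IntermediateField.adjoin (bfld K c) (range (gammaPt u)) ↔
      z ∈ IntermediateField.adjoin (fieldOf K) (allGens c ∪ range (gammaPt u)) := by
    intro z
    rw [← IntermediateField.mem_restrictScalars (fieldOf K), IntermediateField.adjoin_adjoin_left]
  have hAE : ∀ z ∈ K ⊔ Submodule.span ℚ (range c), z ∈ bfld K c := fun z hz => mem_adjoinField_of_mem_sup hz
  have hEeq : IntermediateField.adjoin (bfld K c) (range (y ∘ σ)) =
      IntermediateField.adjoin (bfld K c) (↑s₀ : Set F) := by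
    refine le_antisymm (IntermediateField.adjoin.mono _ _ _ ?_) (IntermediateField.adjoin_le_iff.2 ?_)
    · rintro _ ⟨j, rfl⟩; exact hys₀ _
    · intro z hz
      -- `z = β + Σ r x` with `β ∈ B`; the `u`-part of `β` is algebraic, hence in `A`
      have hzB : z ∈ (K ⊔ Submodule.span ℚ (range c)) ⊔ Submodule.span ℚ (range u) ⊔
          Submodule.span ℚ (range (y ∘ σ)) := by
        rw [hspan]
        obtain ⟨i, rfl⟩ : ∃ i, y i = z := ⟨s₀.equivFin ⟨z, hz⟩, by simp [hy]⟩
        exact Submodule.mem_sup_right (Submodule.subset_span ⟨i, rfl⟩)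
      obtain ⟨β, hβ, w, hw, hsum⟩ := Submodule.mem_sup.1 hzB
      obtain ⟨r, rfl⟩ := (Submodule.mem_span_range_iff_exists_fun ℚ).1 hw
      obtain ⟨a, ha, v, hv, hsum'⟩ := Submodule.mem_sup.1 hβ
      obtain ⟨q, rfl⟩ := (Submodule.mem_span_range_iff_exists_fun ℚ).1 hv
      -- `Σ q u` is algebraic over `⟨K c⟩`
      have hint : IsIntegral (bfld K c) (∑ i, q i • u i) := by
        have heq : ∑ i, q i • u i = z - a - ∑ i, r i • (y ∘ σ) i := by
          rw [← hsum, ← hsum']; abel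
        rw [heq]
        refine IsIntegral.sub (IsIntegral.sub (hs₀alg z hz).isIntegral ?_) ?_
        · exact (isAlgebraic_algebraMap (⟨a, hAE a ha⟩ : bfld K c)).isIntegral
        · refine IsIntegral.sum _ fun i _ => ?_
          rw [Rat.smul_def]
          have h1 : IsIntegral (bfld K c) ((r i : ℚ) : F) := by
            have := isIntegral_algebraMap (R := bfld K c) (A := F)
              (x := ⟨(r i : F), SubfieldClass.ratCast_mem _ _⟩)
            rwa [IntermediateField.algebraMap_apply] at this
          exact h1.mul (hxalg i).isIntegral
      have hqu : ∑ i, q i • u i ∈ K ⊔ Submodule.span ℚ (range c) :=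
        hcase _ (Submodule.mem_sup_right (Submodule.sum_mem _ fun i _ =>
          Submodule.smul_mem _ _ (Submodule.subset_span ⟨i, rfl⟩)))
          (acl_subset_acl_of_subset (coe_bfld_subset_acl K c) (mem_acl_coe_of_isAlgebraic _ hint.isAlgebraic))
      have hzeq : z = (a + ∑ i, q i • u i) + ∑ i, r i • (y ∘ σ) i := by rw [hsum', hsum]
      rw [hzeq]
      refine add_mem ?_ (sum_mem fun i _ => ?_)
      · exact IntermediateField.algebraMap_mem _ (⟨_, hAE _ (add_mem ha hqu)⟩ : bfld K c)
      · rw [Rat.smul_def]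
        exact mul_mem (SubfieldClass.ratCast_mem _ _) (IntermediateField.subset_adjoin _ _ ⟨i, rfl⟩)
  have hrac₁ : ∀ z ∈ IntermediateField.adjoin (fieldOf K) ((allGens c ∪ range (y ∘ σ)) ∪ range (gammaPt u)),
      IsAlgebraic (IntermediateField.adjoin (fieldOf K) (allGens c ∪ range (y ∘ σ))) z →
        z ∈ IntermediateField.adjoin (fieldOf K) (allGens c ∪ range (y ∘ σ)) := by
    intro z hz halg
    have hL₁ : IntermediateField.adjoin (fieldOf K) (allGens c ∪ range (y ∘ σ)) =
        (IntermediateField.adjoin (bfld K c) (↑s₀ : Set F)).restrictScalars (fieldOf K) := by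
      rw [← hEeq, IntermediateField.adjoin_adjoin_left]
    have hzΩ : z ∈ IntermediateField.adjoin (bfld K c) (range (gammaPt u)) := by
      rw [hmemΩ₂]
      refine (IntermediateField.adjoin_le_iff.2 ?_) hz
      refine union_subset (union_subset ?_ ?_) ?_
      · exact fun w hw => IntermediateField.subset_adjoin _ _ (Or.inl hw)
      · rintro _ ⟨j, rfl⟩; exact (hmemΩ₂ _).1 (hs₀Ω (hys₀ _))
      · exact fun w hw => IntermediateField.subset_adjoin _ _ (Or.inr hw)
    have halg' := isAlgebraic_of_intermediateField_eq hL₁ halg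
    have hmem := hclos z hzΩ halg'
    rw [hL₁, IntermediateField.mem_restrictScalars]
    exact hmem
  have hrac := isAlgClosedIn_adjoinField_allGens_append (K := K) hB hxacl hxind hrac₁
  exact ⟨s, y ∘ σ, x', hγ, hxacl, hxind, hstrong, hstrong', hu₂, htd₂, hrac⟩

end GammaField

end Literature.NumberTheory.Transcendental
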